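import Mathlib
import Literature.MathematicalPhysics.QuantumFieldTheory.Balaban1983to89.B9SectECov

/-! # `Balaban1983to89.B9Eq3185` — B9 Sect. E p. 432, (3.183) ⇒ (3.185): the covariance defined by the Gaussian
# integral (3.183) IS `(I + D̄μ)QG̃₂Q*(I + μ*D̄*)` — kernel-checked at generating-function level

CITATION HEADER.  Unit `b2b-balaban-b09` (gen 14, cell pub-balaban), PAPER SUB-CELL B09 =
T. Balaban, *Propagators for lattice gauge theories in a background field*, Commun. Math. Phys. **99** (1985) 389–434
[`Balaban1985BackgroundPropagators`] (= B9).  Sect. E, p. 432 [PDF 44] (render `1985-cmp99-background-propagators-p044-x2.png`,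
READ AS AN IMAGE — the Euclid text layer is unreliable), verbatim:
*"These identities give
exp(½⟨g, C^{(k)}(Λ)g⟩) = Z̃^{−1}∫dA δ(Q̃A) exp[−½‖R̃D*A‖² + ⟨H₁D̃^{(2)}(QA + D̄μ(QA)), J⟩
  − ½⟨A − DG̃′R̃D*A + Dλ̃(A), (Δ + Δ^{(2)})(A − DG̃′R̃D*A + Dλ̃(A))⟩ + ⟨QA + D̄μ(QA), g⟩], (3.183)
where λ̃(A) = H′C′^{(k)}(Λ)H′*ΔP̃D*A + H′μ(QA) + H′Q′G̃′R̃D*A. (3.184)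
Let us denote a covariance operator of the Gaussian integral in (3.183) by G̃₂, then we obtain
C^{(k)}(Λ) = (I + D̄μ)QG̃₂Q*(I + μ*D̄*). (3.185)
It is the formula we are looking for. The operator G̃² can be related in a simple way to the operator G₂ defined by the
Gaussian integral (3.183), but with the δ-function δ(Q̃A) replaced by exp[−½⟨Q̃A, aQ̃A⟩]. We have
G̃₂ = G₂ − G₂Q̃*(Q̃G₂Q̃*)^{−1}Q̃G₂. (3.186)"*
and, for the reading of `⟨H₁D̃^{(2)}(B), J⟩` as a QUADRATIC FORM in `B`, p. 427 [PDF 39] after (3.155) (the definition of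
`C^{(k)}(Λ)` by its generating function `e^{(1/2)⟨g,C^{(k)}(Λ)g⟩} = (Z^{(k)}(Λ))^{−1}∫dB↾_Λ δ(Q₁B)δ_{Ax}(B)·exp[… + ⟨H₁D̃^{(2)}(B), J⟩
+ ⟨B, g⟩] (3.155)`): *"the function D̃^{(2)}(B) is a quadratic polynomial in B with properties similar to C^{(2)}(A), only
restricted to unit blocks, and g is an arbitrary Lie algebra valued function defined at bonds of Λ. The quadratic form in
the above integral can be written also as ⟨B,(QG₁Q*)^{−1}B⟩ − a⟨B,B⟩ − 2⟨H₁D̃^{(2)}(B),J⟩ = ⟨B, Δ_kB⟩. (3.156)"*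
(p. 428 [PDF 40]); and p. 432: *"Theorem 3.15. For Mα₀ sufficiently small the propagator C^{(k)}(Λ) is given by the
formula (3.185), and satisfies the bound …"* (the first clause is `eq_3185` below; the bound is [r1's] `B9Thm315Decay`).

THE POINT.  (3.185) is a statement about a Gaussian integral with a δ-function constraint `δ(Q̃A)`, a quadratic
exponent `−½⟨A, KA⟩` (everything in the exponent of (3.183) except the source is quadratic in `A`: the gauge-fixing term
`‖R̃D*A‖²`, the `J`-form of the observed field `QA + D̄μ(QA)`, and the main form evaluated on the LINEAR configuration
`TA = A − DG̃′R̃D*A + Dλ̃(A)`, `λ̃` linear by (3.184)), and a source coupled through the LINEAR OBSERVATION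
`PA = QA + D̄μ(QA) = (I + D̄μ)QA`.  For such an integral the generating function is `exp(½⟨g, P·G̃₂·Pᵀg⟩)` with `G̃₂` the
covariance of the constrained Gaussian (`flucCov K Q̃`, [an2's] bordered-inverse block, BY NAME) — hence the symmetric
operator `C^{(k)}(Λ)` DEFINED by the left-hand side ((3.155): the generating function) is `P G̃₂ Pᵀ = (I + D̄μ)QG̃₂Q*(I + μ*D̄*)`.
That is exactly the printed sentence, and it is kernel-checked here, closing the item *"(3.185) itself"* listed as NOT
proved in [b09 g13's] `B9SectECov` header (where (3.185) enters §6 as a hypothesis) — at the schematic level: the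
quadratic form `K` is assembled from the printed pieces of (3.183) (`K3183`, `exponent_3183`) over abstract real
matrices; the identification of those pieces with the block-spin objects of [5] is the located residual (C-B9-57 (ii)).

WHAT THIS FILE CERTIFIES (kernel; finite index types: `b` fine bonds (the variable `A`), `ν` coordinates of `N(Q̃)`
(a kernel basis `N`, `Q̃N = 0`), `τ` the rows of `Q̃`, `b₁` first-level bonds (the observed field), `m` the sites where
`μ` lives; `μ` = a matrix `Mu : m × b₁`):
1. `genFun_constrained_obs` — for `K` with `NᵀKN` positive definite, kernel basis `N` of `Q̃` (`Q̃N = 0`, `NᵀN`, `Q̃Q̃ᵀ`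
   nonsingular, `b ≃ ν ⊕ τ`) and ANY observation `P : b₁ × b`:
   `Z̃⁻¹ ∫_{ν → ℝ} exp[−½⟨Nv, KNv⟩ + ⟨PNv, g⟩] dv = exp(½⟨g, P·flucCov K Q̃·Pᵀ g⟩)`
   ([g13's] `B9SectECov.genFun_map` + [an2's] `blocks_eq_kernelBasis`, BY NAME; `Z̃` = the same integral at `g = 0`).
2. `eq_3185` — uniqueness: a symmetric `C` with `exp(½⟨g, Cg⟩) =` that integral for all `g` IS `P·flucCov K Q̃·Pᵀ`
   ([g13's] `eq_of_genFun_eq`).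
3. `obs_3183`, `transpose_obs`, `eq_3185_literal` — with `P = (1 + D̄·Mu)·Q`: `PA = QA + D̄μ(QA)` (the field inside
   `⟨·, g⟩` and `H₁D̃^{(2)}(·)` of (3.183)), `Pᵀ = Qᵀ(1 + Muᵀ D̄ᵀ)` ("`Q*(I + μ*D̄*)`"), and
   `C = (1 + D̄Mu)Q · G̃₂ · Qᵀ(1 + MuᵀD̄ᵀ)`, `G̃₂ = flucCov K Q̃` — (3.185) literally.
4. `K3183`, `exponent_3183`, `genFun_3183` — the quadratic form of (3.183) assembled from its printed pieces,
   `K = (R̃D*)ᵀ(R̃D*) − 2Pᵀ𝒥P + Tᵀ(Δ + Δ^{(2)})T` (`𝒥` = the symmetric form `B ↦ ⟨H₁D̃^{(2)}(B), J⟩`, `T` the linear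
   configuration map), the identity `−½‖R̃D*A‖² + ⟨PA, 𝒥PA⟩ − ½⟨TA, (Δ + Δ^{(2)})TA⟩ = −½⟨A, KA⟩`, and item 1 for the
   (3.183) integrand written with these pieces.
5. `eq_3185_via_G2` — (3.185) with `G̃₂` expressed through `G₂ = (K + aQ̃ᵀQ̃)⁻¹` by (3.186) ([g13's] `eq_3186_scalar`,
   BY NAME).
WHAT IT DOES NOT CERTIFY: positivity of the (3.183) form on `N(Q̃)` (hypothesis `hT : (NᵀKN).PosDef` — implicit in the
print's "covariance operator of the Gaussian integral"); the identification of `K`'s pieces (`R̃D*`, `𝒥`, `Δ + Δ^{(2)}`,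
`T`, `μ`) with the concrete block-spin operators of [5]/B7 (C-B9-57 residual (ii)); the substitution algebra producing
`T` and `P` from (3.170) (that is [this lineage's] `B9Eq3184`: `config_3183`, `source_3183`); the Faddeev–Popov step and
the constants `Z̃`; the G₂-analysis and the random-walk expansion (G-B9-10); Theorem 3.15's bound ((3.185) ⇒ (3.187) is
[r1's] `B9Thm315Decay` / [g12's] `B9Eq3187Op`, which take (3.185) as the datum `Rep3185`).
MODELLING / DIVERGENCE (recorded as D-b09.51): (a) `δ(Q̃A)` ↦ integration over `N(Q̃)` in a kernel basis `N`
(`A = Nv`, Lebesgue `dv`; the basis Gram factor cancels against `Z̃`, so the normalised generating function is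
basis-free); (b) `‖·‖` = the real `ℓ²` norm, `‖x‖² ↦ x ⬝ᵥ x`; (c) `⟨H₁D̃^{(2)}(B), J⟩ ↦ B ⬝ᵥ 𝒥B` with `𝒥` a real matrix
(only its symmetric part matters); (d) `μ` ↦ a matrix `Mu`, `μ*` ↦ `Muᵀ`, `D̄*` ↦ `D̄ᵀ`, `Q*` ↦ `Qᵀ` (real adjoints);
(e) real scalar entries, arbitrary finite index types.
RECORDS: GAPS C-B9-72; DIVERGENCE D-b09.51.  No `sorry`, no new axioms. -/

namespace Literature.MathematicalPhysics.QuantumFieldTheory.Balaban1983to89.B9Eq3185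

open MeasureTheory Matrix Real
open Literature.MathematicalPhysics.QuantumFieldTheory.Balaban1983to89.Beta.CompositionSingular

variable {b ν τ b₁ m n : Type*}

/-! ## §1  The generating function of a linearly observed, `δ(Q̃A)`-constrained Gaussian -/

/-- `(PN)(NᵀKN)⁻¹(PN)ᵀ = P·cov K N·Pᵀ` (`cov K N = N(NᵀKN)⁻¹Nᵀ`, [an2's] `Beta.LogDetHessian.cov`). [folklore] -/
theorem obsCov_eq [Fintype b] [Fintype ν] [DecidableEq ν] (K : Matrix b b ℝ) (N : Matrix b ν ℝ) (P : Matrix b₁ b ℝ) :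
    P * N * (Nᵀ * K * N)⁻¹ * (P * N)ᵀ = P * Beta.LogDetHessian.cov K N * Pᵀ := by
  unfold Beta.LogDetHessian.cov
  rw [Matrix.transpose_mul]
  simp only [Matrix.mul_assoc]

/-- **The generating function with constraint and observation.**  For a quadratic form `K` on `b → ℝ` positive definite
on `N(Q̃)` (kernel basis `N`: `Q̃N = 0`, `NᵀN` and `Q̃Q̃ᵀ` nonsingular, `b ≃ ν ⊕ τ`) and any linear observation `P`,
`Z̃⁻¹ ∫ exp[−½⟨Nv, KNv⟩ + ⟨PNv, g⟩] dv = exp(½⟨g, P·flucCov K Q̃·Pᵀ g⟩)`, `Z̃` the same integral at `g = 0`.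
[cite: Balaban1985BackgroundPropagators, (3.183)/(3.185) p.432] -/
theorem genFun_constrained_obs [Fintype b] [Fintype ν] [Fintype τ] [Fintype b₁] [DecidableEq b] [DecidableEq ν]
    [DecidableEq τ] (e : b ≃ ν ⊕ τ) (K : Matrix b b ℝ) (Qt : Matrix τ b ℝ) (N : Matrix b ν ℝ) (hQN : Qt * N = 0)
    (hNA : IsUnit (Nᵀ * N).det) (hQM : IsUnit (Qt * Qtᵀ).det) (hT : (Nᵀ * K * N).PosDef) (P : Matrix b₁ b ℝ)
    (g : b₁ → ℝ) :
    (∫ v : ν → ℝ, Real.exp (-(1/2 : ℝ) * ((N *ᵥ v) ⬝ᵥ K *ᵥ (N *ᵥ v))))⁻¹ *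
        ∫ v : ν → ℝ, Real.exp (-(1/2 : ℝ) * ((N *ᵥ v) ⬝ᵥ K *ᵥ (N *ᵥ v)) + (P *ᵥ (N *ᵥ v)) ⬝ᵥ g) =
      Real.exp ((1/2 : ℝ) * (g ⬝ᵥ (P * flucCov K Qt * Pᵀ) *ᵥ g)) := by
  simp_rw [B9SectECov.config_quadForm N K, Matrix.mulVec_mulVec, B9SectECov.config_source (P * N) g]
  rw [B9SectECov.genFun_map (Nᵀ * K * N) hT (P * N) g,
    (blocks_eq_kernelBasis e K Qt N hQN hNA hQM ((Matrix.isUnit_iff_isUnit_det _).mp hT.isUnit)).1, obsCov_eq]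

/-- `P·flucCov K Q̃·Pᵀ` is symmetric for symmetric `K` ([an2's] `minOpL_eq_transpose`). [folklore] -/
theorem transpose_obsFlucCov [Fintype b] [Fintype τ] [DecidableEq b] [DecidableEq τ] (K : Matrix b b ℝ)
    (hK : Kᵀ = K) (Qt : Matrix τ b ℝ) (P : Matrix b₁ b ℝ) :
    (P * flucCov K Qt * Pᵀ)ᵀ = P * flucCov K Qt * Pᵀ := by
  rw [Matrix.transpose_mul, Matrix.transpose_mul, Matrix.transpose_transpose, (minOpL_eq_transpose K Qt hK).2.1,
    Matrix.mul_assoc]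

/-- **(3.185)** *"Let us denote a covariance operator of the Gaussian integral in (3.183) by G̃₂, then we obtain
C^{(k)}(Λ) = (I + D̄μ)QG̃₂Q*(I + μ*D̄*)"*: the symmetric operator `C` DEFINED by the generating function
`exp(½⟨g, Cg⟩) = Z̃⁻¹∫_{N(Q̃)} exp[−½⟨A, KA⟩ + ⟨PA, g⟩]` (all `g`) is `P·G̃₂·Pᵀ`, `G̃₂ = flucCov K Q̃`.
[cite: Balaban1985BackgroundPropagators, (3.185) p.432] -/
theorem eq_3185 [Fintype b] [Fintype ν] [Fintype τ] [Fintype b₁] [DecidableEq b] [DecidableEq ν] [DecidableEq τ]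
    (e : b ≃ ν ⊕ τ) (K : Matrix b b ℝ) (hK : Kᵀ = K) (Qt : Matrix τ b ℝ) (N : Matrix b ν ℝ) (hQN : Qt * N = 0)
    (hNA : IsUnit (Nᵀ * N).det) (hQM : IsUnit (Qt * Qtᵀ).det) (hT : (Nᵀ * K * N).PosDef) (P : Matrix b₁ b ℝ)
    (C : Matrix b₁ b₁ ℝ) (hC : Cᵀ = C)
    (hgen : ∀ g : b₁ → ℝ, Real.exp ((1/2 : ℝ) * (g ⬝ᵥ C *ᵥ g)) =
      (∫ v : ν → ℝ, Real.exp (-(1/2 : ℝ) * ((N *ᵥ v) ⬝ᵥ K *ᵥ (N *ᵥ v))))⁻¹ *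
        ∫ v : ν → ℝ, Real.exp (-(1/2 : ℝ) * ((N *ᵥ v) ⬝ᵥ K *ᵥ (N *ᵥ v)) + (P *ᵥ (N *ᵥ v)) ⬝ᵥ g)) :
    C = P * flucCov K Qt * Pᵀ :=
  B9SectECov.eq_of_genFun_eq hC (transpose_obsFlucCov K hK Qt P) fun g => by
    rw [hgen g, genFun_constrained_obs e K Qt N hQN hNA hQM hT P g]

/-! ## §2  (3.185) literally: the observation `P = (I + D̄μ)Q` -/

/-- The observed field of (3.183): `((1 + D̄Mu)Q)A = QA + D̄μ(QA)`. [cite: Balaban1985BackgroundPropagators, (3.183) p.432] -/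
theorem obs_3183 [Fintype b] [Fintype b₁] [Fintype m] [DecidableEq b₁] (Q : Matrix b₁ b ℝ) (Db : Matrix b₁ m ℝ)
    (Mu : Matrix m b₁ ℝ) (A : b → ℝ) :
    ((1 + Db * Mu) * Q) *ᵥ A = Q *ᵥ A + Db *ᵥ (Mu *ᵥ (Q *ᵥ A)) := by
  rw [← Matrix.mulVec_mulVec, Matrix.add_mulVec, Matrix.one_mulVec, ← Matrix.mulVec_mulVec]

/-- `((1 + D̄Mu)Q)ᵀ = Qᵀ(1 + MuᵀD̄ᵀ)` — the factor *"Q*(I + μ*D̄*)"* of (3.185). [cite: Balaban1985BackgroundPropagators, (3.185) p.432] -/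
theorem transpose_obs [Fintype b₁] [Fintype m] [DecidableEq b₁] (Q : Matrix b₁ b ℝ) (Db : Matrix b₁ m ℝ)
    (Mu : Matrix m b₁ ℝ) : ((1 + Db * Mu) * Q)ᵀ = Qᵀ * (1 + Muᵀ * Dbᵀ) := by
  rw [Matrix.transpose_mul, Matrix.transpose_add, Matrix.transpose_one, Matrix.transpose_mul]

/-- **(3.185) in the printed shape** `C^{(k)}(Λ) = (I + D̄μ)Q·G̃₂·Q*(I + μ*D̄*)`, `G̃₂ = flucCov K Q̃`.
[cite: Balaban1985BackgroundPropagators, (3.185) p.432] -/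
theorem eq_3185_literal [Fintype b] [Fintype ν] [Fintype τ] [Fintype b₁] [Fintype m] [DecidableEq b]
    [DecidableEq ν] [DecidableEq τ] [DecidableEq b₁] (e : b ≃ ν ⊕ τ) (K : Matrix b b ℝ) (hK : Kᵀ = K)
    (Qt : Matrix τ b ℝ) (N : Matrix b ν ℝ) (hQN : Qt * N = 0) (hNA : IsUnit (Nᵀ * N).det)
    (hQM : IsUnit (Qt * Qtᵀ).det) (hT : (Nᵀ * K * N).PosDef) (Q : Matrix b₁ b ℝ) (Db : Matrix b₁ m ℝ)
    (Mu : Matrix m b₁ ℝ) (C : Matrix b₁ b₁ ℝ) (hC : Cᵀ = C)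
    (hgen : ∀ g : b₁ → ℝ, Real.exp ((1/2 : ℝ) * (g ⬝ᵥ C *ᵥ g)) =
      (∫ v : ν → ℝ, Real.exp (-(1/2 : ℝ) * ((N *ᵥ v) ⬝ᵥ K *ᵥ (N *ᵥ v))))⁻¹ *
        ∫ v : ν → ℝ, Real.exp (-(1/2 : ℝ) * ((N *ᵥ v) ⬝ᵥ K *ᵥ (N *ᵥ v)) +
          (Q *ᵥ (N *ᵥ v) + Db *ᵥ (Mu *ᵥ (Q *ᵥ (N *ᵥ v)))) ⬝ᵥ g)) :
    C = (1 + Db * Mu) * Q * flucCov K Qt * Qᵀ * (1 + Muᵀ * Dbᵀ) := by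
  have h := eq_3185 e K hK Qt N hQN hNA hQM hT ((1 + Db * Mu) * Q) C hC (fun g => by
    simp_rw [obs_3183]; exact hgen g)
  rw [h, transpose_obs, Matrix.mul_assoc _ Qᵀ]

/-! ## §3  The quadratic form of (3.183) assembled from its printed pieces -/

/-- `K` of (3.183): `(R̃D*)ᵀ(R̃D*) − 2Pᵀ𝒥P + Tᵀ(Δ + Δ^{(2)})T` (`RDt = R̃D*`, `𝒥` the `J`-form of the observed field,
`W = Δ + Δ^{(2)}`, `T` the configuration map `A ↦ A − DG̃′R̃D*A + Dλ̃(A)`).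
[cite: Balaban1985BackgroundPropagators, (3.183) p.432] -/
def K3183 [Fintype b] [Fintype b₁] [Fintype n] (RDt : Matrix n b ℝ) (𝒥 : Matrix b₁ b₁ ℝ) (P : Matrix b₁ b ℝ)
    (W T : Matrix b b ℝ) : Matrix b b ℝ :=
  RDtᵀ * RDt - (2 : ℝ) • (Pᵀ * 𝒥 * P) + Tᵀ * W * T

/-- `‖Mx‖² = ⟨x, MᵀMx⟩`. [folklore] -/
theorem normSq_eq [Fintype b] [Fintype n] (M : Matrix n b ℝ) (A : b → ℝ) :
    (M *ᵥ A) ⬝ᵥ (M *ᵥ A) = A ⬝ᵥ (Mᵀ * M) *ᵥ A := by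
  rw [← Matrix.mulVec_mulVec, Matrix.dotProduct_mulVec A Mᵀ, Matrix.vecMul_transpose]

/-- **The exponent of (3.183) is `−½⟨A, KA⟩` (plus the source):**
`−½‖R̃D*A‖² + ⟨PA, 𝒥PA⟩ − ½⟨TA, (Δ + Δ^{(2)})TA⟩ = −½⟨A, K3183·A⟩`. [cite: Balaban1985BackgroundPropagators, (3.183) p.432] -/
theorem exponent_3183 [Fintype b] [Fintype b₁] [Fintype n] (RDt : Matrix n b ℝ) (𝒥 : Matrix b₁ b₁ ℝ)
    (P : Matrix b₁ b ℝ) (W T : Matrix b b ℝ) (A : b → ℝ) :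
    -(1/2 : ℝ) * ((RDt *ᵥ A) ⬝ᵥ (RDt *ᵥ A)) + (P *ᵥ A) ⬝ᵥ 𝒥 *ᵥ (P *ᵥ A) -
        (1/2 : ℝ) * ((T *ᵥ A) ⬝ᵥ W *ᵥ (T *ᵥ A)) =
      -(1/2 : ℝ) * (A ⬝ᵥ K3183 RDt 𝒥 P W T *ᵥ A) := by
  unfold K3183
  rw [normSq_eq, B9SectECov.config_quadForm P 𝒥 A, B9SectECov.config_quadForm T W A]
  simp only [Matrix.add_mulVec, Matrix.sub_mulVec, Matrix.smul_mulVec, dotProduct_add, dotProduct_sub,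
    dotProduct_smul, smul_eq_mul]
  ring

/-- **(3.183) ⇒ (3.185) with the printed integrand**: the normalised `δ(Q̃A)`-constrained integral of
`exp[−½‖R̃D*A‖² + ⟨PA, 𝒥PA⟩ − ½⟨TA, (Δ + Δ^{(2)})TA⟩ + ⟨PA, g⟩]` (`A = Nv ∈ N(Q̃)`) equals
`exp(½⟨g, P·flucCov K3183 Q̃·Pᵀ g⟩)`. [cite: Balaban1985BackgroundPropagators, (3.183)-(3.185) p.432] -/
theorem genFun_3183 [Fintype b] [Fintype ν] [Fintype τ] [Fintype b₁] [Fintype n] [DecidableEq b] [DecidableEq ν]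
    [DecidableEq τ] (e : b ≃ ν ⊕ τ) (RDt : Matrix n b ℝ) (𝒥 : Matrix b₁ b₁ ℝ) (P : Matrix b₁ b ℝ)
    (W T : Matrix b b ℝ) (Qt : Matrix τ b ℝ) (N : Matrix b ν ℝ) (hQN : Qt * N = 0) (hNA : IsUnit (Nᵀ * N).det)
    (hQM : IsUnit (Qt * Qtᵀ).det) (hT : (Nᵀ * K3183 RDt 𝒥 P W T * N).PosDef) (g : b₁ → ℝ) :
    (∫ v : ν → ℝ, Real.exp (-(1/2 : ℝ) * ((N *ᵥ v) ⬝ᵥ K3183 RDt 𝒥 P W T *ᵥ (N *ᵥ v))))⁻¹ *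
        ∫ v : ν → ℝ, Real.exp (-(1/2 : ℝ) * ((RDt *ᵥ (N *ᵥ v)) ⬝ᵥ (RDt *ᵥ (N *ᵥ v))) +
          (P *ᵥ (N *ᵥ v)) ⬝ᵥ 𝒥 *ᵥ (P *ᵥ (N *ᵥ v)) - (1/2 : ℝ) * ((T *ᵥ (N *ᵥ v)) ⬝ᵥ W *ᵥ (T *ᵥ (N *ᵥ v))) +
          (P *ᵥ (N *ᵥ v)) ⬝ᵥ g) =
      Real.exp ((1/2 : ℝ) * (g ⬝ᵥ (P * flucCov (K3183 RDt 𝒥 P W T) Qt * Pᵀ) *ᵥ g)) := by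
  simp_rw [exponent_3183 RDt 𝒥 P W T]
  exact genFun_constrained_obs e (K3183 RDt 𝒥 P W T) Qt N hQN hNA hQM hT P g

/-! ## §4  (3.185) with `G̃₂` through `G₂` — (3.186) by name -/

/-- (3.185) ∧ (3.186): `C = P·[G₂ − G₂Q̃ᵀ(Q̃G₂Q̃ᵀ)⁻¹Q̃G₂]·Pᵀ`, `G₂ = (K + aQ̃ᵀQ̃)⁻¹` — [g13's] `B9SectECov.eq_3186_scalar`
BY NAME. [cite: Balaban1985BackgroundPropagators, (3.185)-(3.186) p.432] -/
theorem eq_3185_via_G2 [Fintype b] [Fintype ν] [Fintype τ] [Fintype b₁] [DecidableEq b] [DecidableEq ν]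
    [DecidableEq τ] (e : b ≃ ν ⊕ τ) (K : Matrix b b ℝ) (hK : Kᵀ = K) (Qt : Matrix τ b ℝ) (N : Matrix b ν ℝ)
    (hQN : Qt * N = 0) (hNA : IsUnit (Nᵀ * N).det) (hQM : IsUnit (Qt * Qtᵀ).det) (hT : (Nᵀ * K * N).PosDef)
    (P : Matrix b₁ b ℝ) (C : Matrix b₁ b₁ ℝ) (hC : Cᵀ = C)
    (hgen : ∀ g : b₁ → ℝ, Real.exp ((1/2 : ℝ) * (g ⬝ᵥ C *ᵥ g)) =
      (∫ v : ν → ℝ, Real.exp (-(1/2 : ℝ) * ((N *ᵥ v) ⬝ᵥ K *ᵥ (N *ᵥ v))))⁻¹ *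
        ∫ v : ν → ℝ, Real.exp (-(1/2 : ℝ) * ((N *ᵥ v) ⬝ᵥ K *ᵥ (N *ᵥ v)) + (P *ᵥ (N *ᵥ v)) ⬝ᵥ g))
    (a : ℝ) (hG : IsUnit (K + a • (Qtᵀ * Qt)).det) (hP : IsUnit (Qt * (K + a • (Qtᵀ * Qt))⁻¹ * Qtᵀ).det) :
    C = P * ((K + a • (Qtᵀ * Qt))⁻¹ -
      (K + a • (Qtᵀ * Qt))⁻¹ * Qtᵀ * (Qt * (K + a • (Qtᵀ * Qt))⁻¹ * Qtᵀ)⁻¹ * Qt * (K + a • (Qtᵀ * Qt))⁻¹) * Pᵀ := by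
  rw [eq_3185 e K hK Qt N hQN hNA hQM hT P C hC hgen, B9SectECov.eq_3186_scalar K Qt a hG hP]

end Literature.MathematicalPhysics.QuantumFieldTheory.Balaban1983to89.B9Eq3185
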